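import Summits.CriticalPhenomena.PercolationContinuityZ3.Theorems.Transplant.FKDoubleFanOneSidedConeSShift
import Mathlib.Analysis.SpecialFunctions.Exponential
import Mathlib.Analysis.SpecialFunctions.Log.Basic
import Mathlib.Analysis.Normed.Module.FiniteDimension
import Mathlib.Topology.Order.Compact
import HarnessLib

/-!
# Double fans `K₂ ∨ P_{m+1}`: the EXACT criterion for `HypBaS` — cross-positivity of `T_b` (tangency at the boundary of the `a`-sided cone)

Helper file (`--supports stmt-CriticalPhenomena-4575`), FK sub-lane `prim-bschramm-fk-3` (gen 39); builds on p205010 (kernel theorem, internal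
audit signed; external expert review pending).  No named facts, no sorries; standard axioms.  Memo `bschramm/prim-bschramm-fk-3/FAR-CROSS-XIV.md`.

`…OneSidedConeS` reduces the far cross-apex theorem for all middles to the `B`-stability `HypBaS q` of the closed cone `osConeS q` (bi-dual of
the `a`-images); `…ConeSShift` gave the SUFFICIENT uniform shifted criterion `(T_b + C)·imgA ∈ osConeS`.  Since `∧²BC_y = (1−y)²·exp(s T_b)`
(`eˢ = 1/(1−y)`) is a semigroup generated by the diagonal operator `T_b` (weights `0,1,2`), `B`-stability of a closed convex cone is EQUIVALENT
to CROSS-POSITIVITY of `T_b` (Schneider–Vidyasagar): `⟪T_b β, ρ⟫ ≥ 0` whenever `β` lies in a compact generating set of the cone, `ρ` in the dual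
and `⟪β, ρ⟫ = 0` — i.e. `T_b β` lies in the TANGENT CONE `cl(K + ℝβ)` at `β`.  Elementary proof here (no ODEs): the resolvent
`R_h = diag(1, (1−h)⁻¹, (1−2h)⁻¹)` (**`scaleTb`**, **`res_sub_opTb`**) preserves the dual by a variational argument (**`pdual_of_sub`**, **`pdual_res`**;
abstract family `α : X → Biv`, strictly positive functional `e₀`, attained ratio minima), hence so do its iterates (**`pdual_res_pow`**), their
limits `diag(1, eˢ, e²ˢ)` (`(1 − s/n)⁻ⁿ → eˢ`, **`pdual_exp`**) and every `∧²BC_y` (**`pdual_opBC`**).  Instantiation: **`atomClosure q`** (closure in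
`ℝ¹⁰` of the normalised non-zero `a`-images; compact; its half-space dual is `OSDualS q`, **`osDualS_iff_atomClosure`**); **`hypBaS_of_crossPos`**
(`0 < q ≤ 1`: a functional `e₀` with `c·‖imgA‖ ≤ ⟪imgA, e₀⟫` plus cross-positivity on `atomClosure q` ⟹ `HypBaS q`, hence the far cross-apex theorem
by `negCorr_spokes_cross_far_of_hypBaS`); **`crossPos_of_hypBaS`** (the criterion is exact); **`crossPos_of_shift`** (implied by `HypShiftS`).
Use (memo XIV): a certificate at a generator `a = imgA F w` may contain a free multiple of `a` and all derivative directions `∂ imgA` along curves in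
`InS × InS` through `(F, w)`; at the degenerate-gadget corner, where every `(T_b + C)d` is a boundary point, `T_b d = ∂_ε imgA(δ₀ + εe_ac, P_b𝟙)|₀`.
[folklore]
-/

noncomputable section

open Filter Topology

namespace Summit.CriticalPhenomena.PercolationContinuityZ3.Theorems

namespace FK

namespace ThreeApex

/-! ### The diagonal operators on the three `T_b`-weight classes and the resolvent of `T_b` -/

/-- `diag(r, s, t)` on the `T_b`-weight classes: `r` on `ux, uy, xy` (weight 0), `s` on `uz, uv, xz, xv, yz, yv` (weight 1), `t` on `zv`
(weight 2). [folklore] -/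
def scaleTb (r s t : ℝ) (β : Biv) : Biv :=
  ⟨r * β.ux, r * β.uy, s * β.uz, s * β.uv, r * β.xy, s * β.xz, s * β.xv, s * β.yz, s * β.yv, t * β.zv⟩

/-- `diag(1,1,1) = id`. [folklore] -/
theorem scaleTb_one (β : Biv) : scaleTb 1 1 1 β = β := by
  ext <;> simp [scaleTb]

/-- The diagonal operators compose multiplicatively. [folklore] -/
theorem scaleTb_scaleTb (r s t r' s' t' : ℝ) (β : Biv) :
    scaleTb r s t (scaleTb r' s' t' β) = scaleTb (r * r') (s * s') (t * t') β := by
  ext <;> simp [scaleTb] <;> ring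

/-- Scalar multiples of a diagonal operator. [folklore] -/
theorem smul_scaleTb (c r s t : ℝ) (β : Biv) : Biv.smul c (scaleTb r s t β) = scaleTb (c * r) (c * s) (c * t) β := by
  ext <;> simp [scaleTb, Biv.smul] <;> ring

/-- The weight-0 part of the pairing. [folklore] -/
def pair0 (q : ℝ) (β γ : Biv) : ℝ := (1 - q) ^ 2 * (2 - q) * (β.ux * γ.ux + β.uy * γ.uy) - (1 - q) ^ 2 * (β.xy * γ.xy)

/-- The weight-1 part of the pairing. [folklore] -/
def pair1 (q : ℝ) (β γ : Biv) : ℝ :=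
  (1 - q) ^ 2 * (2 - q) * (β.uz * γ.uz) - (1 - q) * (2 - q) * β.uv * γ.uv - (1 - q) ^ 2 * (β.xz * γ.xz + β.yz * γ.yz)
    + (1 - q) * (β.xv * γ.xv + β.yv * γ.yv)

/-- The weight-2 part of the pairing. [folklore] -/
def pair2 (q : ℝ) (β γ : Biv) : ℝ := (1 - q) * (β.zv * γ.zv)

/-- The pairing against `diag(r,s,t)ρ` is affine in `(r, s, t)`. [folklore] -/
theorem pairH_scaleTb_right (q r s t : ℝ) (β ρ : Biv) :
    pairH q β (scaleTb r s t ρ) = r * pair0 q β ρ + s * pair1 q β ρ + t * pair2 q β ρ := by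
  simp only [pairH, scaleTb, pair0, pair1, pair2]; ring

/-- `∧²BC_y = diag((1−y)², 1−y, 1)`. [folklore] -/
theorem opBC_eq_scaleTb (y : ℝ) (β : Biv) : opBC y β = scaleTb ((1 - y) ^ 2) (1 - y) 1 β := by
  ext <;> simp [opBC, opTb, opWb, Biv.lin3, Biv.add, Biv.smul, scaleTb] <;> ring

/-- **The resolvent identity**: `R_h ρ − h·T_b (R_h ρ) = ρ` for `R_h = diag(1, (1−h)⁻¹, (1−2h)⁻¹)`, `h ≠ 1, 1/2`. [folklore] -/
theorem res_sub_opTb {h : ℝ} (h1 : 1 - h ≠ 0) (h2 : 1 - 2 * h ≠ 0) (ρ : Biv) :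
    Biv.add (scaleTb 1 (1 - h)⁻¹ (1 - 2 * h)⁻¹ ρ) (Biv.smul (-h) (opTb (scaleTb 1 (1 - h)⁻¹ (1 - 2 * h)⁻¹ ρ))) = ρ := by
  ext <;> simp [scaleTb, opTb, Biv.add, Biv.smul] <;> field_simp <;> ring

/-- `pairH` is linear in the second slot: scalars. [folklore] -/
theorem pairH_smul_right' (q c : ℝ) (β γ : Biv) : pairH q β (Biv.smul c γ) = c * pairH q β γ := by
  rw [pairH_comm, pairH_smul_left, pairH_comm]

/-- `pairH` is linear in the second slot: sums. [folklore] -/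
theorem pairH_add_right' (q : ℝ) (β γ δ : Biv) : pairH q β (Biv.add γ δ) = pairH q β γ + pairH q β δ := by
  rw [pairH_comm, pairH_add_left, pairH_comm q γ, pairH_comm q δ]

/-! ### The abstract variational step and its iteration -/

section Abstract

variable {X : Type*} (q : ℝ) (P : Set X) (α : X → Biv)

/-- The half-space dual of the family `α` on `P`. [folklore] -/
def PDual (ρ : Biv) : Prop := ∀ x ∈ P, 0 ≤ pairH q (α x) ρ

variable {q P α}

/-- The dual is a cone. [folklore] -/
theorem PDual.smul {ρ : Biv} (h : PDual q P α ρ) {c : ℝ} (hc : 0 ≤ c) : PDual q P α (Biv.smul c ρ) :=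
  fun x hx => by rw [pairH_smul_right']; exact mul_nonneg hc (h x hx)

variable {e₀ : Biv} {M : ℝ} (he : ∀ x ∈ P, 0 < pairH q (α x) e₀) (hM : ∀ x ∈ P, pairH q (α x) (opTb e₀) ≤ M * pairH q (α x) e₀)
  (hmin : ∀ ρ : Biv, (∃ x ∈ P, pairH q (α x) ρ < 0) →
    ∃ x₀ ∈ P, ∀ x ∈ P, pairH q (α x₀) ρ * pairH q (α x) e₀ ≤ pairH q (α x) ρ * pairH q (α x₀) e₀)
  (hcross : ∀ x ∈ P, ∀ ρ : Biv, PDual q P α ρ → pairH q (α x) ρ = 0 → 0 ≤ pairH q (opTb (α x)) ρ)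
include he hM hmin hcross

/-- **The variational step.**  Let `e₀` be strictly positive on the family, `⟪α x, T_b e₀⟫ ≤ M ⟪α x, e₀⟫`, let every ratio `⟪α ·, ρ⟫/⟪α ·, e₀⟫`
that takes a negative value attain its minimum on `P`, and let `T_b` be cross-positive (`⟪T_b (α x), ρ'⟫ ≥ 0` whenever `ρ'` is in the dual and
`⟪α x, ρ'⟫ = 0`).  Then for `0 < h`, `h·M < 1`: if `ρ − h·T_b ρ` is in the dual, so is `ρ`. [folklore] -/
theorem pdual_of_sub {h : ℝ} (hh : 0 < h) (hhM : h * M < 1) {ρ : Biv} (hρ : PDual q P α (Biv.add ρ (Biv.smul (-h) (opTb ρ)))) :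
    PDual q P α ρ := by
  by_contra hneg
  simp only [PDual, not_forall, not_le] at hneg
  obtain ⟨x₁, hx₁, hneg₁⟩ := hneg
  obtain ⟨x₀, hx₀, hmin₀⟩ := hmin ρ ⟨x₁, hx₁, hneg₁⟩
  set E := pairH q (α x₀) e₀ with hE
  set R := pairH q (α x₀) ρ with hR
  have hE0 : 0 < E := he x₀ hx₀
  have hR0 : R < 0 := by
    have h1 := hmin₀ x₁ hx₁
    have h2 : pairH q (α x₁) ρ * E < 0 := mul_neg_of_neg_of_pos hneg₁ hE0
    nlinarith [he x₁ hx₁]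
  set ρ' : Biv := Biv.add ρ (Biv.smul (-(R / E)) e₀) with hρ'
  have hρ'dual : PDual q P α ρ' := by
    intro x hx
    rw [hρ', pairH_add_right', pairH_smul_right']
    have h1 := hmin₀ x hx
    have : R / E * pairH q (α x) e₀ ≤ pairH q (α x) ρ := by
      rw [div_mul_eq_mul_div, div_le_iff₀ hE0]; linarith
    linarith
  have hρ'zero : pairH q (α x₀) ρ' = 0 := by
    rw [hρ', pairH_add_right', pairH_smul_right']; field_simp; ring
  have hcr := hcross x₀ hx₀ ρ' hρ'dual hρ'zero
  rw [hρ', pairH_add_right', pairH_smul_right'] at hcr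
  have hsub := hρ x₀ hx₀
  rw [pairH_add_right', pairH_smul_right', ← pairH_opTb] at hsub
  have hMe : pairH q (opTb (α x₀)) e₀ ≤ M * E := by rw [pairH_opTb]; exact hM x₀ hx₀
  have hRE : R / E < 0 := div_neg_of_neg_of_pos hR0 hE0
  have h3 : R * M ≤ R / E * pairH q (opTb (α x₀)) e₀ := by
    have := mul_le_mul_of_nonpos_left hMe hRE.le
    calc R * M = R / E * (M * E) := by field_simp
      _ ≤ R / E * pairH q (opTb (α x₀)) e₀ := this
  have h4 : R * M ≤ pairH q (opTb (α x₀)) ρ := by linarith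
  have h5 : h * pairH q (opTb (α x₀)) ρ ≤ R := by linarith
  have h6 : h * (R * M) ≤ R := le_trans (mul_le_mul_of_nonneg_left h4 hh.le) h5
  nlinarith

/-- **Resolvent stability of the dual**: `ρ ∈ dual ⟹ R_h ρ ∈ dual` (`0 < h < 1/2`, `hM < 1`). [folklore] -/
theorem pdual_res {h : ℝ} (hh : 0 < h) (hh2 : h < 1 / 2) (hhM : h * M < 1) {ρ : Biv} (hρ : PDual q P α ρ) :
    PDual q P α (scaleTb 1 (1 - h)⁻¹ (1 - 2 * h)⁻¹ ρ) := by
  have h1 : 1 - h ≠ 0 := by intro e; linarith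
  have h2 : 1 - 2 * h ≠ 0 := by intro e; linarith
  refine pdual_of_sub he hM hmin hcross hh hhM ?_
  rw [res_sub_opTb h1 h2]; exact hρ

/-- Iterated resolvents: the dual is stable under `diag(1, (1−h)⁻ⁿ, (1−2h)⁻ⁿ)`. [folklore] -/
theorem pdual_res_pow {h : ℝ} (hh : 0 < h) (hh2 : h < 1 / 2) (hhM : h * M < 1) {ρ : Biv} (hρ : PDual q P α ρ) (n : ℕ) :
    PDual q P α (scaleTb 1 ((1 - h)⁻¹ ^ n) ((1 - 2 * h)⁻¹ ^ n) ρ) := by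
  induction n with
  | zero => simpa [scaleTb_one] using hρ
  | succ n ih =>
    have := pdual_res he hM hmin hcross hh hh2 hhM ih
    rw [scaleTb_scaleTb] at this
    simpa [pow_succ, mul_comm] using this

/-- **The exponential of `T_b`**: the dual is stable under `diag(1, eˢ, e²ˢ)` for every `s ≥ 0` (limit of iterated resolvents with `h = s/n`).
[folklore] -/
theorem pdual_exp (hM0 : 0 < M) {s : ℝ} (hs : 0 ≤ s) {ρ : Biv} (hρ : PDual q P α ρ) :
    PDual q P α (scaleTb 1 (Real.exp s) (Real.exp (2 * s)) ρ) := by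
  rcases hs.eq_or_lt with rfl | hs0
  · intro x hx; simpa [scaleTb_one] using hρ x hx
  intro x hx
  have hA : Tendsto (fun n : ℕ => ((1 + -s / (n : ℝ)) ^ n)⁻¹) atTop (𝓝 (Real.exp s)) := by
    have := (Real.tendsto_one_add_div_pow_exp (-s)).inv₀ (Real.exp_pos _).ne'
    simpa [Real.exp_neg] using this
  have hB : Tendsto (fun n : ℕ => ((1 + -(2 * s) / (n : ℝ)) ^ n)⁻¹) atTop (𝓝 (Real.exp (2 * s))) := by
    have := (Real.tendsto_one_add_div_pow_exp (-(2 * s))).inv₀ (Real.exp_pos _).ne'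
    simpa [Real.exp_neg] using this
  have hlim : Tendsto (fun n : ℕ => pairH q (α x) (scaleTb 1 (((1 + -s / (n : ℝ)) ^ n)⁻¹) (((1 + -(2 * s) / (n : ℝ)) ^ n)⁻¹) ρ))
      atTop (𝓝 (pairH q (α x) (scaleTb 1 (Real.exp s) (Real.exp (2 * s)) ρ))) := by
    simp only [pairH_scaleTb_right]
    exact ((tendsto_const_nhds.add (hA.mul_const _)).add (hB.mul_const _))
  refine ge_of_tendsto hlim ?_
  have hsn : Tendsto (fun n : ℕ => s / (n : ℝ)) atTop (𝓝 0) := tendsto_const_div_atTop_nhds_zero_nat s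
  have hev1 : ∀ᶠ n : ℕ in atTop, s / (n : ℝ) < min (1 / 2) (1 / M) :=
    (tendsto_order.1 hsn).2 _ (lt_min (by norm_num) (by positivity))
  have hev2 : ∀ᶠ n : ℕ in atTop, 0 < n := eventually_gt_atTop 0
  filter_upwards [hev1, hev2] with n hn1 hn2
  have hnpos : (0 : ℝ) < n := by exact_mod_cast hn2
  have hh : 0 < s / (n : ℝ) := div_pos hs0 hnpos
  have hh2 : s / (n : ℝ) < 1 / 2 := lt_of_lt_of_le hn1 (min_le_left _ _)
  have hhM : s / (n : ℝ) * M < 1 := by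
    have : s / (n : ℝ) < 1 / M := lt_of_lt_of_le hn1 (min_le_right _ _)
    rwa [lt_div_iff₀ hM0] at this
  have key := pdual_res_pow he hM hmin hcross hh hh2 hhM hρ n x hx
  have e1 : (1 - s / (n : ℝ))⁻¹ ^ n = ((1 + -s / (n : ℝ)) ^ n)⁻¹ := by rw [inv_pow]; ring_nf
  have e2 : (1 - 2 * (s / (n : ℝ)))⁻¹ ^ n = ((1 + -(2 * s) / (n : ℝ)) ^ n)⁻¹ := by rw [inv_pow]; ring_nf
  rwa [e1, e2] at key

/-- **`B`-stability of the dual**: under cross-positivity the dual is stable under every `∧²BC_y`, `y ∈ [0,1)`. [folklore] -/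
theorem pdual_opBC (hM0 : 0 < M) {y : ℝ} (hy0 : 0 ≤ y) (hy1 : y < 1) {ρ : Biv} (hρ : PDual q P α ρ) :
    PDual q P α (opBC y ρ) := by
  have h1y : 0 < 1 - y := sub_pos.2 hy1
  set s : ℝ := -Real.log (1 - y) with hs
  have hs0 : 0 ≤ s := by rw [hs, neg_nonneg]; exact Real.log_nonpos (sub_nonneg.2 hy1.le) (by linarith)
  have hexp : Real.exp s = (1 - y)⁻¹ := by rw [hs, Real.exp_neg, Real.exp_log h1y]
  have hexp2 : Real.exp (2 * s) = (1 - y)⁻¹ ^ 2 := by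
    rw [← hexp, sq, ← Real.exp_add]; ring_nf
  have key := (pdual_exp he hM hmin hcross hM0 hs0 hρ).smul (sq_nonneg (1 - y))
  rw [hexp, hexp2, smul_scaleTb] at key
  have e : opBC y ρ = scaleTb ((1 - y) ^ 2 * 1) ((1 - y) ^ 2 * (1 - y)⁻¹) ((1 - y) ^ 2 * (1 - y)⁻¹ ^ 2) ρ := by
    rw [opBC_eq_scaleTb]; congr 1 <;> field_simp
  rw [e]; exact key

end Abstract

/-! ### The instantiation: normalised `a`-images in `ℝ¹⁰` -/

/-- The coordinate vector of a bivector. [folklore] -/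
def Biv.toFun (β : Biv) : Fin 10 → ℝ := ![β.ux, β.uy, β.uz, β.uv, β.xy, β.xz, β.xv, β.yz, β.yv, β.zv]

/-- The bivector with given coordinates. [folklore] -/
def Biv.ofFun (v : Fin 10 → ℝ) : Biv := ⟨v 0, v 1, v 2, v 3, v 4, v 5, v 6, v 7, v 8, v 9⟩

/-- Round trip. [folklore] -/
theorem Biv.ofFun_toFun (β : Biv) : Biv.ofFun (Biv.toFun β) = β := by
  ext <;> simp [Biv.ofFun, Biv.toFun]

/-- `ofFun` is linear: scalars. [folklore] -/
theorem Biv.ofFun_smul (c : ℝ) (v : Fin 10 → ℝ) : Biv.ofFun (c • v) = Biv.smul c (Biv.ofFun v) := by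
  ext <;> simp [Biv.ofFun, Biv.smul]

/-- `ofFun 0 = 0`. [folklore] -/
theorem pairH_ofFun_zero (q : ℝ) (ρ : Biv) : pairH q (Biv.ofFun 0) ρ = 0 := by
  simp [Biv.ofFun, pairH]

/-- The pairing is a continuous function of the coordinates. [folklore] -/
theorem continuous_pairH_ofFun (q : ℝ) (ρ : Biv) : Continuous fun v : Fin 10 → ℝ => pairH q (Biv.ofFun v) ρ := by
  simp only [pairH, Biv.ofFun]
  fun_prop

/-- The set of normalised non-zero `a`-images `imgA q F w`, `F, w ∈ InS q`, as coordinate vectors. [folklore] -/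
def atomSet (q : ℝ) : Set (Fin 10 → ℝ) :=
  {v | ∃ F w : V5, InS q F ∧ InS q w ∧ Biv.toFun (imgA q F w) ≠ 0 ∧ v = ‖Biv.toFun (imgA q F w)‖⁻¹ • Biv.toFun (imgA q F w)}

/-- **The compact generating set**: the closure of the normalised `a`-images. [folklore] -/
def atomClosure (q : ℝ) : Set (Fin 10 → ℝ) := closure (atomSet q)

/-- Normalised atoms lie in the closed unit ball. [folklore] -/
theorem atomSet_subset_closedBall (q : ℝ) : atomSet q ⊆ Metric.closedBall 0 1 := by
  rintro v ⟨F, w, -, -, hne, rfl⟩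
  rw [Metric.mem_closedBall, dist_zero_right, norm_smul, norm_inv, norm_norm, inv_mul_cancel₀ (norm_ne_zero_iff.2 hne)]

/-- `atomClosure q` is compact. [folklore] -/
theorem isCompact_atomClosure (q : ℝ) : IsCompact (atomClosure q) :=
  (isCompact_closedBall (0 : Fin 10 → ℝ) 1).of_isClosed_subset isClosed_closure
    (closure_minimal (atomSet_subset_closedBall q) Metric.isClosed_closedBall)

/-- A non-zero atom: the input frame of `δ₀` (`0 < q ≤ 1`). [folklore] -/
theorem atomSet_nonempty {q : ℝ} (hq0 : 0 < q) (hq1 : q ≤ 1) : (atomSet q).Nonempty := by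
  have hF : InS q fanInit := (fanInit_inKE q).inS hq0 hq1
  have hw : InS q delta0 := (InKE.base (q := q)).inS hq0 hq1
  have hne : Biv.toFun (imgA q fanInit delta0) ≠ 0 := by
    intro h
    have h1 : Biv.toFun (imgA q fanInit delta0) 1 = 0 := by rw [h]; rfl
    rw [imgA_fanInit] at h1
    simp [Biv.toFun, wedgeH, conv, edgeAC, delta0, hy, V5.total] at h1
  exact ⟨_, fanInit, delta0, hF, hw, hne, rfl⟩

/-- `atomClosure q` is nonempty (`0 < q ≤ 1`). [folklore] -/
theorem atomClosure_nonempty {q : ℝ} (hq0 : 0 < q) (hq1 : q ≤ 1) : (atomClosure q).Nonempty :=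
  (atomSet_nonempty hq0 hq1).mono subset_closure

/-- A closed half-space condition that holds on the atoms holds on the closure. [folklore] -/
theorem atomClosure_le_of_atoms {q : ℝ} {ρ : Biv} {c : ℝ}
    (h : ∀ F w : V5, InS q F → InS q w → c * ‖Biv.toFun (imgA q F w)‖ ≤ pairH q (imgA q F w) ρ) :
    ∀ v ∈ atomClosure q, c ≤ pairH q (Biv.ofFun v) ρ := by
  have hcl : IsClosed {v : Fin 10 → ℝ | c ≤ pairH q (Biv.ofFun v) ρ} := isClosed_le continuous_const (continuous_pairH_ofFun q ρ)
  refine fun v hv => closure_minimal ?_ hcl hv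
  rintro v ⟨F, w, hF, hw, hne, rfl⟩
  have hn : 0 < ‖Biv.toFun (imgA q F w)‖ := norm_pos_iff.2 hne
  show c ≤ pairH q (Biv.ofFun (‖Biv.toFun (imgA q F w)‖⁻¹ • Biv.toFun (imgA q F w))) ρ
  rw [Biv.ofFun_smul, pairH_smul_left, Biv.ofFun_toFun, le_inv_mul_iff₀ hn]
  simpa [mul_comm] using h F w hF hw

/-- **The half-space dual of `atomClosure q` is `OSDualS q`.** [folklore] -/
theorem osDualS_iff_atomClosure (q : ℝ) (ρ : Biv) :
    OSDualS q ρ ↔ PDual q (atomClosure q) (fun v => Biv.ofFun v) ρ := by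
  constructor
  · intro hρ v hv
    have := atomClosure_le_of_atoms (q := q) (ρ := ρ) (c := 0) (fun F w hF hw => by simpa using hρ F w hF hw) v hv
    simpa using this
  · intro h F w hF hw
    by_cases hne : Biv.toFun (imgA q F w) = 0
    · have e : imgA q F w = Biv.ofFun 0 := by rw [← hne, Biv.ofFun_toFun]
      rw [e, pairH_ofFun_zero]
    · have hn : 0 < ‖Biv.toFun (imgA q F w)‖ := norm_pos_iff.2 hne
      have hv : ‖Biv.toFun (imgA q F w)‖⁻¹ • Biv.toFun (imgA q F w) ∈ atomClosure q :=
        subset_closure ⟨F, w, hF, hw, hne, rfl⟩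
      have := h _ hv
      dsimp only at this
      rw [Biv.ofFun_smul, pairH_smul_left, Biv.ofFun_toFun] at this
      exact (mul_nonneg_iff_of_pos_left (inv_pos.2 hn)).1 this

/-- Points of the closure lie in the (closed) cone `osConeS q`. [folklore] -/
theorem ofFun_mem_osConeS_of_mem_atomClosure {q : ℝ} {v : Fin 10 → ℝ} (hv : v ∈ atomClosure q) : Biv.ofFun v ∈ osConeS q := by
  intro γ hγ
  exact (osDualS_iff_atomClosure q γ).1 hγ v hv

/-! ### The exact criterion -/

/-- **`HypBaS` from cross-positivity of `T_b`** (`0 < q ≤ 1`): if some functional `e₀` is uniformly positive on the `a`-images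
(`c·‖imgA‖ ≤ ⟪imgA, e₀⟫`, `c > 0`) and `⟪T_b β, ρ⟫ ≥ 0` for every `β` in the closure of the normalised `a`-images and every `ρ ∈ OSDualS q`
with `⟪β, ρ⟫ = 0`, then `HypBaS q` — and with it (`negCorr_spokes_cross_far_of_hypBaS`) the far cross-apex theorem for all middles. [folklore] -/
theorem hypBaS_of_crossPos {q : ℝ} (hq0 : 0 < q) (hq1 : q ≤ 1) (e₀ : Biv) {c : ℝ} (hc : 0 < c)
    (hpos : ∀ F w : V5, InS q F → InS q w → c * ‖Biv.toFun (imgA q F w)‖ ≤ pairH q (imgA q F w) e₀)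
    (hcross : ∀ v ∈ atomClosure q, ∀ ρ : Biv, OSDualS q ρ → pairH q (Biv.ofFun v) ρ = 0 → 0 ≤ pairH q (opTb (Biv.ofFun v)) ρ) :
    HypBaS q := by
  set P := atomClosure q
  set α : (Fin 10 → ℝ) → Biv := fun v => Biv.ofFun v
  have hPc : IsCompact P := isCompact_atomClosure q
  have hPn : P.Nonempty := atomClosure_nonempty hq0 hq1
  have hec : ∀ v ∈ P, c ≤ pairH q (α v) e₀ := atomClosure_le_of_atoms hpos
  have he : ∀ v ∈ P, 0 < pairH q (α v) e₀ := fun v hv => lt_of_lt_of_le hc (hec v hv)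
  have hcont : ∀ ρ : Biv, ContinuousOn (fun v => pairH q (α v) ρ) P := fun ρ => (continuous_pairH_ofFun q ρ).continuousOn
  have hcontq : ∀ ρ : Biv, ContinuousOn (fun v => pairH q (α v) ρ / pairH q (α v) e₀) P :=
    fun ρ => (hcont ρ).div (hcont e₀) fun v hv => (he v hv).ne'
  obtain ⟨vM, hvM, hmax⟩ := hPc.exists_isMaxOn hPn (hcontq (opTb e₀))
  set M : ℝ := max (pairH q (α vM) (opTb e₀) / pairH q (α vM) e₀) 1 with hMdef
  have hM0 : 0 < M := lt_of_lt_of_le zero_lt_one (le_max_right _ _)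
  have hM : ∀ v ∈ P, pairH q (α v) (opTb e₀) ≤ M * pairH q (α v) e₀ :=
    fun v hv => (div_le_iff₀ (he v hv)).1 (le_trans (hmax hv) (le_max_left _ _))
  have hmin : ∀ ρ : Biv, (∃ x ∈ P, pairH q (α x) ρ < 0) →
      ∃ x₀ ∈ P, ∀ x ∈ P, pairH q (α x₀) ρ * pairH q (α x) e₀ ≤ pairH q (α x) ρ * pairH q (α x₀) e₀ := by
    intro ρ _
    obtain ⟨x₀, hx₀, hmin⟩ := hPc.exists_isMinOn hPn (hcontq ρ)
    exact ⟨x₀, hx₀, fun x hx => (div_le_div_iff₀ (he x₀ hx₀) (he x hx)).1 (hmin hx)⟩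
  have hcross' : ∀ x ∈ P, ∀ ρ : Biv, PDual q P α ρ → pairH q (α x) ρ = 0 → 0 ≤ pairH q (opTb (α x)) ρ :=
    fun x hx ρ hρ h0 => hcross x hx ρ ((osDualS_iff_atomClosure q ρ).2 hρ) h0
  have hdual : ∀ ρ : Biv, OSDualS q ρ → ∀ y : ℝ, 0 ≤ y → y < 1 → OSDualS q (opBC y ρ) := by
    intro ρ hρ y hy0 hy1
    exact (osDualS_iff_atomClosure q _).2
      (pdual_opBC he hM hmin hcross' hM0 hy0 hy1 ((osDualS_iff_atomClosure q ρ).1 hρ))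
  have hlt : ∀ F w : V5, InS q F → InS q w → ∀ y : ℝ, 0 ≤ y → y < 1 → opBC y (imgA q F w) ∈ osConeS q := by
    intro F w hF hw y hy0 hy1 ρ hρ
    rw [pairH_opBC]
    exact hdual ρ hρ y hy0 hy1 F w hF hw
  intro F w y hF hw hy0 hy1
  rcases lt_or_eq_of_le hy1 with h | rfl
  · exact hlt F w hF hw y hy0 h
  · exact opBC_one_mem_osConeS_of_lt fun y' hy'0 hy'1 => hlt F w hF hw y' hy'0 hy'1

/-- **The criterion is exact**: `HypBaS q` implies cross-positivity of `T_b` on the closure of the normalised `a`-images. [folklore] -/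
theorem crossPos_of_hypBaS {q : ℝ} (hB : HypBaS q) :
    ∀ v ∈ atomClosure q, ∀ ρ : Biv, OSDualS q ρ → pairH q (Biv.ofFun v) ρ = 0 → 0 ≤ pairH q (opTb (Biv.ofFun v)) ρ := by
  intro v hv ρ hρ h0
  set β := Biv.ofFun v with hβ
  have hβK : β ∈ osConeS q := ofFun_mem_osConeS_of_mem_atomClosure hv
  have hg : ∀ y : ℝ, 0 ≤ y → y ≤ 1 → 0 ≤ y * (1 - y) * pairH q (opTb β) ρ + y ^ 2 * pairH q (opWb β) ρ := by
    intro y hy0 hy1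
    have := hβK _ (hρ.bc hB hy0 hy1)
    rwa [← pairH_opBC, pairH_opBC_poly, h0, mul_zero, zero_add] at this
  by_contra hT; rw [not_le] at hT
  set T := pairH q (opTb β) ρ with hTdef
  set W := pairH q (opWb β) ρ with hWdef
  by_cases hW : W ≤ 0
  · have := hg (1 / 2) (by norm_num) (by norm_num)
    nlinarith
  · rw [not_le] at hW
    have hWT : 0 < W - T := by linarith
    set y : ℝ := -T / (2 * (W - T)) with hy
    have hy0 : 0 < y := by rw [hy]; exact div_pos (by linarith) (by linarith)
    have hy1 : y ≤ 1 / 2 := by rw [hy, div_le_iff₀ (by linarith)]; linarith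
    have := hg y hy0.le (by linarith)
    have e : y * (1 - y) * T + y ^ 2 * W = y * (T + y * (W - T)) := by ring
    have e2 : y * (W - T) = -T / 2 := by rw [hy]; field_simp
    rw [e, e2] at this
    nlinarith

/-- **The shifted criterion implies cross-positivity**: `HypShiftS q C` (`…ConeSShift`) gives `⟪T_b β, ρ⟫ = ⟪(T_b + C) β, ρ⟫ ≥ 0` at
`⟪β, ρ⟫ = 0`. [folklore] -/
theorem crossPos_of_shift {q C : ℝ} (h : HypShiftS q C) :
    ∀ v ∈ atomClosure q, ∀ ρ : Biv, OSDualS q ρ → pairH q (Biv.ofFun v) ρ = 0 → 0 ≤ pairH q (opTb (Biv.ofFun v)) ρ := by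
  intro v hv ρ hρ h0
  have := shiftTb_mem_osConeS h (ofFun_mem_osConeS_of_mem_atomClosure hv) ρ hρ
  rwa [shiftTb, pairH_add_left, pairH_smul_left, h0, mul_zero, add_zero] at this

end ThreeApex

end FK

end Summit.CriticalPhenomena.PercolationContinuityZ3.Theorems
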